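import Mathlib
import Literature.Analysis.FunctionSpaces.PoissonPointProcess
import Literature.Analysis.FunctionSpaces.PoissonMecke
import Literature.Probability.LatticeModels.IsingModel
import Literature.Probability.LatticeModels.ScalingLimit
import Literature.Probability.LatticeModels.DelaunayGraph
import HarnessLib

/-!
# The annealed Ising correlator of a Poisson–Delaunay device

Topic `Literature/Probability/LatticeModels`; definition request `defn-annealedDeviceCorr` of route
`Summits/CriticalPhenomena/Ising3DConformalLimit/Theses/ConformalPoissonDevice`, whose items
`DeviceWeylUniversality`, `DeviceTwoPointConformal`, `DeviceInversionSymmetry` quantify the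
correlator `F` through its defining equation `hF : F N β n x = <inline term>`. Everything here is
a definition or PROVED; there are no named facts.

## The object

A *device configuration* is a locally finite point configuration `ω` of `ℝᵈ`
(`PointConfig`) drawn from a law `P` — in the route the Poisson process of intensity
`N (1 + ‖z‖²)⁻³ dz` on `ℝ³` (the uniform Poisson process of `S³ ⊂ ℝ⁴` pushed down
stereographically), a.s. finite. On a finite `ω` one puts (i) the **pencil-rule graph**
`devicePencilGraph ω h`: distinct sites `p, q` are joined iff some non-zero form
`Q z = a‖z‖² + ⟪b, z⟫ + c` vanishes at `p, q` and is `≥ 0` on `ω` (`IsMoebiusDelaunayPair` of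
file `DelaunayGraph`; in general position the 1-skeleton of the convex hull of the
stereographic lift, Brown 1979), realised as the route writes it by `SimpleGraph.fromRel` on
the vertex type `↥h.toFinset`, `h : ω.Finite`; (ii) the n.n. Ising model with ONE coupling,
inverse temperature `β`, field `0`, free boundary condition on the whole vertex set — the
tree's `isingExpect G univ β 0 .free` (Friedli–Velenik 2017, §3.1); (iii) the **chordal
read-out** `x ↦ chordalNearest ω x`, a site minimising `‖x − p‖² / (1 + ‖p‖²)`, i.e. nearest
to `x` in the chordal metric of the sphere pulled back by stereographic projection
(`chord(x,p)² = 4‖x − p‖² / ((1 + ‖x‖²)(1 + ‖p‖²))`). The **annealed device correlator** is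
`annealedDeviceCorr P β n x = ∫ ⟨∏ᵢ σ_{chordalNearest ω xᵢ}⟩^∅_{ω;β,0} dP(ω)` (integrand `0`
on infinite `ω`). Ising models on Poissonian (Voronoi–)Delaunay random lattices go back to
Christ–Friedberg–Lee 1982 (Itzykson–Drouffe 1989, §11.1: Poissonian lattices, the
Dirichlet–Voronoi construction); the route's "annealed" correlator is the lattice-ensemble
average of the quenched expectation `⟨·⟩_ω` (not an annealed Gibbs measure).

## Results (all proved)

`annealedDeviceCorr_apply` (`rfl` to the verbatim inline term: the items' `hF` becomes
`fun _ _ _ _ => rfl`), `annealedDeviceCorr_eq_integral`, `abs_annealedDeviceCorr_le_one`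
(`|F| ≤ 1`, no measurability needed), `isingExpect_univ_free_eq_zero_of_odd` (spin flip),
`annealedDeviceCorr_zero` (`F(0,·) = P.real {ω finite}`), `annealedDeviceCorr_of_odd` (odd `n`:
`F(n,x) = P.real {ω = ∅}`, `= e^{-ν(ℝᵈ)}` for a Poisson law — the EMPTY configuration contributes
the empty product `1`: exponentially small, not zero), `annealedDeviceCorr_comp_perm`.

## Design notes; what is NOT here

* The body of `annealedDeviceCorr` is syntactically the route's inline term (`Classical.epsilon`
  read-out, `SimpleGraph.fromRel` on `↥h.toFinset`); the structured pieces are attached by `rfl`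
  lemmas. The dimension `d` is implicit (`d = 3` in the route).
* Junk values: integrand `0` on infinite configurations and `1` on the empty one for every `n`;
  at a configuration with ties in the chordal criterion `Classical.epsilon` picks an unspecified
  minimiser (ties are null for Poisson laws with a density; not proved here).
* NOT here: measurability of `deviceGibbsAverage β n x` for the count σ-algebra (needs a
  measurable labelling of finite configurations; the bounds hold without it, a non-integrable
  integrand having Bochner integral `0`); `O(d)`/inversion equivariance of the integrand (route
  item `DeviceInversionSymmetry`: graph part = `moebiusDelaunayGraphInversionIso` composed with
  `devicePencilGraphIso`, read-out part needs a unique chordal minimiser); criticality.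

## References

* N. H. Christ, R. Friedberg, T. D. Lee, Nucl. Phys. B 202 (1982) 89–125.
* C. Itzykson, J.-M. Drouffe, *Statistical Field Theory* 2, CUP 1989, §11.1.
* S. Friedli, Y. Velenik, *Statistical Mechanics of Lattice Systems*, CUP 2017, §3.1, §3.7.1.
* G. Last, M. Penrose, *Lectures on the Poisson Process*, CUP 2017, Def. 3.1; J. F. C. Kingman,
  *Poisson Processes*, Oxford 1993, §2.1; K. Q. Brown, Inform. Process. Lett. 9 (1979) 223–228.
-/

noncomputable section

open scoped Classical
open MeasureTheory Literature.Analysis.FunctionSpaces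

namespace Literature.Probability.LatticeModels

/-! ### The chordal read-out and the pencil-rule graph on the `Finset` of sites -/

section Geometry

variable {F : Type*} [NormedAddCommGroup F]

/-- **Chordal read-out.** For sites `ω` and a point `x` of a normed group, a site of `ω`
minimising `‖x − p‖² / (1 + ‖p‖²)`, chosen by `Classical.epsilon` (unspecified if there is no
minimiser, e.g. `ω = ∅`, or which one in case of ties). For `x, p ∈ ℝᵈ` the criterion is
`(1 + ‖x‖²)/4 · chord(x, p)²` with `chord(x, p) = 2‖x − p‖ / √((1 + ‖x‖²)(1 + ‖p‖²))` the
chordal distance of the inverse stereographic images on the unit sphere `Sᵈ ⊂ ℝᵈ⁺¹`: the site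
nearest to `x` in the spherical metric — the read-out of the `S³` device of route
`ConformalPoissonDevice`, written there inline as this `Classical.epsilon` term. [folklore] -/
def chordalNearest (ω : Set F) (x : F) : F :=
  Classical.epsilon fun p => p ∈ ω ∧ ∀ q ∈ ω,
    ‖x - p‖ ^ 2 / (1 + ‖p‖ ^ 2) ≤ ‖x - q‖ ^ 2 / (1 + ‖q‖ ^ 2)

/-- For a finite non-empty set of sites the chordal read-out is a site of `ω` minimising the
chordal criterion (`Set.exists_min_image`, `Classical.epsilon_spec`). [folklore] -/
theorem chordalNearest_spec {ω : Set F} (hω : ω.Finite) (hne : ω.Nonempty) (x : F) :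
    chordalNearest ω x ∈ ω ∧ ∀ q ∈ ω,
      ‖x - chordalNearest ω x‖ ^ 2 / (1 + ‖chordalNearest ω x‖ ^ 2) ≤
        ‖x - q‖ ^ 2 / (1 + ‖q‖ ^ 2) := by
  obtain ⟨p, hp, hmin⟩ :=
    Set.exists_min_image ω (fun p => ‖x - p‖ ^ 2 / (1 + ‖p‖ ^ 2)) hω hne
  exact Classical.epsilon_spec (p := fun p => p ∈ ω ∧ ∀ q ∈ ω,
    ‖x - p‖ ^ 2 / (1 + ‖p‖ ^ 2) ≤ ‖x - q‖ ^ 2 / (1 + ‖q‖ ^ 2)) ⟨p, hp, hmin⟩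

/-- For a finite non-empty set of sites the chordal read-out is a site. [folklore] -/
theorem chordalNearest_mem {ω : Set F} (hω : ω.Finite) (hne : ω.Nonempty) (x : F) :
    chordalNearest ω x ∈ ω :=
  (chordalNearest_spec hω hne x).1

variable [InnerProductSpace ℝ F]

/-- The **pencil-rule graph of a finite configuration on its `Finset` of sites**: vertex type
`↥h.toFinset` (`h : ω.Finite`), adjacency `SimpleGraph.fromRel` of the (already symmetric) pencil
rule `IsMoebiusDelaunayPair ω` (Boissonnat–Yvinec 1998, §17.2, completed projectively). Verbatim
the graph written inline in route `ConformalPoissonDevice`; isomorphic to `moebiusDelaunayGraph ω`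
(`devicePencilGraphIso`). An `abbrev`, so that instance search sees `fromRel`. [folklore] -/
abbrev devicePencilGraph (ω : Set F) (h : ω.Finite) : SimpleGraph ↥h.toFinset :=
  SimpleGraph.fromRel fun p q : ↥h.toFinset => IsMoebiusDelaunayPair ω (p : F) (q : F)

/-- Adjacency in `devicePencilGraph`: distinct sites satisfying the pencil rule. [folklore] -/
theorem devicePencilGraph_adj {ω : Set F} (h : ω.Finite) {p q : ↥h.toFinset} :
    (devicePencilGraph ω h).Adj p q ↔ p ≠ q ∧ IsMoebiusDelaunayPair ω (p : F) (q : F) := by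
  rw [SimpleGraph.fromRel_adj]
  exact ⟨fun ⟨hne, h'⟩ => ⟨hne, h'.elim id IsMoebiusDelaunayPair.symm⟩,
    fun ⟨hne, h'⟩ => ⟨hne, Or.inl h'⟩⟩

/-- The pencil-rule graph on the `Finset` of sites is isomorphic to `moebiusDelaunayGraph ω` on
`↥ω` (same sites, same rule), so the equivariance results of `DelaunayGraph`
(e.g. `moebiusDelaunayGraphInversionIso`) transfer to the device graph. [folklore] -/
def devicePencilGraphIso (ω : Set F) (h : ω.Finite) :
    devicePencilGraph ω h ≃g moebiusDelaunayGraph ω where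
  toEquiv := Equiv.subtypeEquivRight fun _ => h.mem_toFinset
  map_rel_iff' := by
    intro p q
    simp only [moebiusDelaunayGraph_adj, devicePencilGraph_adj, ne_eq,
      EmbeddingLike.apply_eq_iff_eq, Equiv.subtypeEquivRight_apply_coe]

end Geometry

/-! ### Odd observables in the free zero-field state on a finite vertex set -/

section FreeFlip

variable {V : Type*} [Fintype V] [DecidableEq V] (G : SimpleGraph V) [G.LocallyFinite]

omit [DecidableEq V] [G.LocallyFinite] in
/-- On the whole vertex set gluing never looks outside `Λ = univ`: the glued configuration of
`-τ` is minus that of `τ` (Friedli–Velenik 2017, §3.1). [cite: FriedliVelenik2017, §3.1] -/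
theorem glue_univ_neg (bc : BoundaryCondition V) (τ : ↥(Finset.univ : Finset V) → ℤˣ) :
    glue Finset.univ (-τ) bc = -glue Finset.univ τ bc := by
  funext x
  rw [Pi.neg_apply, glue_apply_of_mem _ _ _ (Finset.mem_univ x),
    glue_apply_of_mem _ _ _ (Finset.mem_univ x), Pi.neg_apply]

/-- **Spin-flip symmetry of the free zero-field state on a finite vertex set**: an observable odd
under the global flip `σ ↦ -σ` has zero expectation under `μ^∅_{univ;β,0}` — the Boltzmann weight
at `h = 0` is even (`isingWeight_neg_flip`) and the finite Boltzmann sum (`integral_isingMeasure`;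
every `f` is measurable on the finite configuration space) changes sign under `τ ↦ -τ`
(Friedli–Velenik 2017, §3.7.1, eq. (3.33) for `σ_A`). [cite: FriedliVelenik2017, §3.7.1] -/
theorem isingExpect_univ_free_eq_zero_of_odd (β : ℝ) {f : SpinConfig V → ℝ}
    (hf : ∀ σ, f (-σ) = -f σ) : isingExpect G Finset.univ β 0 .free f = 0 := by
  rw [isingExpect, integral_isingMeasure G Finset.univ β 0 .free (measurable_of_countable f)]
  have hw : ∀ τ : ↥(Finset.univ : Finset V) → ℤˣ,
      isingWeight G Finset.univ β 0 .free (-τ) = isingWeight G Finset.univ β 0 .free τ := by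
    intro τ
    simpa using isingWeight_neg_flip G Finset.univ β 0 .free τ
  set S := ∑ τ : ↥(Finset.univ : Finset V) → ℤˣ,
    isingWeight G Finset.univ β 0 .free τ * f (glue Finset.univ τ .free) with hS
  have hSS : S = -S := by
    calc S = ∑ τ : ↥(Finset.univ : Finset V) → ℤˣ,
          isingWeight G Finset.univ β 0 .free (-τ) * f (glue Finset.univ (-τ) .free) :=
          (Fintype.sum_equiv (Equiv.neg _) _ _ fun τ => rfl).symm
      _ = ∑ τ : ↥(Finset.univ : Finset V) → ℤˣ,
          -(isingWeight G Finset.univ β 0 .free τ * f (glue Finset.univ τ .free)) := by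
          refine Finset.sum_congr rfl fun τ _ => ?_
          rw [hw, glue_univ_neg, hf, mul_neg]
      _ = -S := by rw [hS, Finset.sum_neg_distrib]
  rw [show S = 0 by linarith, zero_div]

end FreeFlip

/-! ### The device: observable, quenched Gibbs average, annealed correlator -/

section Device

variable {d : ℕ}

local notation "𝔼" => EuclideanSpace ℝ (Fin d)

/-- The **device observable** read at `x₁, …, xₙ`, on the vertex type `↥h.toFinset`:
`σ ↦ ∏ᵢ ∏_{v : (v : ℝᵈ) = chordalNearest ω xᵢ} σ_v` — each inner product is the single spin
`σ_{chordalNearest ω xᵢ}` when `ω` is finite non-empty (`deviceObservable_eq_prod`) and the empty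
product `1` when `ω = ∅`.
Verbatim the observable written inline in route `ConformalPoissonDevice`. [folklore] -/
def deviceObservable (ω : Set 𝔼) (h : ω.Finite) (n : ℕ) (x : Fin n → 𝔼)
    (σ : SpinConfig ↥h.toFinset) : ℝ :=
  ∏ i, ∏ v ∈ Finset.univ.filter (fun v : ↥h.toFinset => (v : 𝔼) = chordalNearest ω (x i)),
    spinAt v σ

/-- The **quenched Gibbs average of the device at `ω`** (the integrand of `annealedDeviceCorr`):
for finite `ω`, the expectation of `deviceObservable` in the finite-volume Ising Gibbs measure of
the pencil-rule graph of `ω` on its whole vertex set at inverse temperature `β`, field `0`, free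
b.c. — `⟨∏ᵢ σ_{chordalNearest ω xᵢ}⟩^∅_{univ;β,0}` in the notation of Friedli–Velenik 2017, §3.1;
the junk value `0` for an infinite configuration. [cite: FriedliVelenik2017, §3.1] -/
def deviceGibbsAverage (β : ℝ) (n : ℕ) (x : Fin n → 𝔼) (ω : PointConfig 𝔼) : ℝ :=
  if h : (ω : Set 𝔼).Finite then
    isingExpect (devicePencilGraph (ω : Set 𝔼) h) Finset.univ β 0 BoundaryCondition.free
      (deviceObservable (ω : Set 𝔼) h n x)
  else 0

/-- **The annealed device correlator**
`F_P^β(n; x₁, …, xₙ) = ∫ ⟨∏ᵢ σ_{chordalNearest ω xᵢ}⟩^∅_{ω;β,0} dP(ω)`: the average over the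
device law `P` (a measure on locally finite configurations of `ℝᵈ`; integrand `0` on infinite
ones) of the free, zero-field, finite-volume Ising Gibbs expectation at the one coupling `β`, on
the pencil-rule (Möbius–Delaunay) graph of the configuration, of the product of the spins read at
the chordal-nearest sites to `x₁, …, xₙ` — an Ising model on a Poissonian Delaunay random lattice
(Christ–Friedberg–Lee 1982; Itzykson–Drouffe 1989, §11.1) averaged over the lattice ensemble; the
object `F` of the items of route `ConformalPoissonDevice` (`d = 3`). The body is ON PURPOSE
syntactically their inline term (`annealedDeviceCorr_apply`); `annealedDeviceCorr_eq_integral`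
is the structured form. [folklore] -/
def annealedDeviceCorr (P : Measure (PointConfig 𝔼)) (β : ℝ) : CorrFamily d :=
  fun n (x : Fin n → EuclideanSpace ℝ (Fin d)) => ∫ ω, (if h : (ω : Set (EuclideanSpace ℝ (Fin d))).Finite then Literature.Probability.LatticeModels.isingExpect (SimpleGraph.fromRel fun p q : ↥h.toFinset => ∃ (a c : ℝ) (b : EuclideanSpace ℝ (Fin d)), (a ≠ 0 ∨ b ≠ 0 ∨ c ≠ 0) ∧ a * ‖(p : EuclideanSpace ℝ (Fin d))‖ ^ 2 + inner ℝ b (p : EuclideanSpace ℝ (Fin d)) + c = 0 ∧ a * ‖(q : EuclideanSpace ℝ (Fin d))‖ ^ 2 + inner ℝ b (q : EuclideanSpace ℝ (Fin d)) + c = 0 ∧ ∀ z ∈ ω, 0 ≤ a * ‖z‖ ^ 2 + inner ℝ b z + c) Finset.univ β 0 Literature.Probability.LatticeModels.BoundaryCondition.free (fun σ => ∏ i, ∏ v ∈ Finset.univ.filter (fun v : ↥h.toFinset => (v : EuclideanSpace ℝ (Fin d)) = Classical.epsilon (fun p : EuclideanSpace ℝ (Fin d) => p ∈ ω ∧ ∀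 q ∈ ω, ‖x i - p‖ ^ 2 / (1 + ‖p‖ ^ 2) ≤ ‖x i - q‖ ^ 2 / (1 + ‖q‖ ^ 2))), Literature.Probability.LatticeModels.spinAt v σ) else 0) ∂P

/-- Unfolding of `annealedDeviceCorr` to the verbatim inline term of the items of route
`ConformalPoissonDevice` (so that their hypothesis `hF` is discharged by `fun _ _ _ _ => rfl`).
[folklore] -/
theorem annealedDeviceCorr_apply (P : Measure (PointConfig 𝔼)) (β : ℝ) (n : ℕ) (x : Fin n → 𝔼) :
    annealedDeviceCorr P β n x = ∫ ω, (if h : (ω : Set (EuclideanSpace ℝ (Fin d))).Finite then Literature.Probability.LatticeModels.isingExpect (SimpleGraph.fromRel fun p q : ↥h.toFinset => ∃ (a c : ℝ) (b : EuclideanSpace ℝ (Fin d)), (a ≠ 0 ∨ b ≠ 0 ∨ c ≠ 0) ∧ a * ‖(p : EuclideanSpace ℝ (Fin d))‖ ^ 2 + inner ℝ b (p : EuclideanSpace ℝ (Fin d)) + c = 0 ∧ a * ‖(q : EuclideanSpace ℝ (Fin d))‖ ^ 2 + inner ℝ b (q : EuclideanSpace ℝ (Fin d)) + c = 0 ∧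 ∀ z ∈ ω, 0 ≤ a * ‖z‖ ^ 2 + inner ℝ b z + c) Finset.univ β 0 Literature.Probability.LatticeModels.BoundaryCondition.free (fun σ => ∏ i, ∏ v ∈ Finset.univ.filter (fun v : ↥h.toFinset => (v : EuclideanSpace ℝ (Fin d)) = Classical.epsilon (fun p : EuclideanSpace ℝ (Fin d) => p ∈ ω ∧ ∀ q ∈ ω, ‖x i - p‖ ^ 2 / (1 + ‖p‖ ^ 2) ≤ ‖x i - q‖ ^ 2 / (1 + ‖q‖ ^ 2))), Literature.Probability.LatticeModels.spinAt v σ) else 0) ∂P :=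
  rfl

/-- **Structured form**: the annealed correlator is the `P`-integral of the quenched Gibbs average
`deviceGibbsAverage β n x` (definitionally: the inline pencil rule is `IsMoebiusDelaunayPair`, the
inline read-out is `chordalNearest`). [folklore] -/
theorem annealedDeviceCorr_eq_integral (P : Measure (PointConfig 𝔼)) (β : ℝ) (n : ℕ)
    (x : Fin n → 𝔼) : annealedDeviceCorr P β n x = ∫ ω, deviceGibbsAverage β n x ω ∂P :=
  rfl

/-! #### The observable -/

/-- `|∏ᵢ ∏ σ_v| = 1`: the device observable takes values in `{−1, 1}`. [folklore] -/
theorem abs_deviceObservable (ω : Set 𝔼) (h : ω.Finite) (n : ℕ) (x : Fin n → 𝔼)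
    (σ : SpinConfig ↥h.toFinset) : |deviceObservable ω h n x σ| = 1 := by
  simp [deviceObservable, Finset.abs_prod, abs_spinAt]

/-- For a finite non-empty configuration the device observable is the spin monomial
`∏ᵢ σ_{chordalNearest ω xᵢ}` (each read-out filter is a single vertex). [folklore] -/
theorem deviceObservable_eq_prod {ω : Set 𝔼} (h : ω.Finite) (hne : ω.Nonempty) (n : ℕ)
    (x : Fin n → 𝔼) (σ : SpinConfig ↥h.toFinset) :
    deviceObservable ω h n x σ = ∏ i, spinAt
      (⟨chordalNearest ω (x i), h.mem_toFinset.2 (chordalNearest_mem h hne (x i))⟩ : ↥h.toFinset)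
      σ := by
  refine Finset.prod_congr rfl fun i _ => ?_
  rw [← Finset.prod_singleton (fun v => spinAt v σ) ⟨chordalNearest ω (x i), _⟩]
  refine Finset.prod_congr ?_ fun _ _ => rfl
  ext v
  simp only [Finset.mem_filter, Finset.mem_univ, true_and, Finset.mem_singleton, Subtype.ext_iff]

/-- Under the global spin flip the device observable of a finite non-empty configuration picks up
the sign `(-1)ⁿ`. [folklore] -/
theorem deviceObservable_neg {ω : Set 𝔼} (h : ω.Finite) (hne : ω.Nonempty) (n : ℕ)
    (x : Fin n → 𝔼) (σ : SpinConfig ↥h.toFinset) :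
    deviceObservable ω h n x (-σ) = (-1) ^ n * deviceObservable ω h n x σ := by
  simp only [deviceObservable_eq_prod h hne, spinAt_neg]
  rw [Finset.prod_neg, Finset.card_univ, Fintype.card_fin]

/-! #### The quenched Gibbs average -/

/-- `|⟨∏ σ⟩| ≤ 1`: the quenched Gibbs average is bounded by `1` (a `{−1,1}`-valued observable
under a probability measure; Friedli–Velenik 2017, §3.6.1). [cite: FriedliVelenik2017, §3.6.1] -/
theorem abs_deviceGibbsAverage_le_one (β : ℝ) (n : ℕ) (x : Fin n → 𝔼) (ω : PointConfig 𝔼) :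
    |deviceGibbsAverage β n x ω| ≤ 1 := by
  unfold deviceGibbsAverage
  split_ifs with h
  · rw [isingExpect, ← Real.norm_eq_abs]
    calc _ ≤ 1 * (isingMeasure (devicePencilGraph _ h) Finset.univ β 0 .free).real Set.univ :=
          norm_integral_le_of_norm_le_const (Filter.Eventually.of_forall fun σ => by
            rw [Real.norm_eq_abs, abs_deviceObservable])
      _ = 1 := by rw [probReal_univ, mul_one]
  · simp

/-- On the EMPTY configuration the integrand is `1` for every `n`: there are no vertices, every
read-out product is empty and the Gibbs measure is a probability measure. [folklore] -/
theorem deviceGibbsAverage_of_eq_empty (β : ℝ) (n : ℕ) (x : Fin n → 𝔼) {ω : PointConfig 𝔼}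
    (hω : (ω : Set 𝔼) = ∅) : deviceGibbsAverage β n x ω = 1 := by
  have hfin : (ω : Set 𝔼).Finite := hω ▸ Set.finite_empty
  rw [deviceGibbsAverage, dif_pos hfin]
  have hobs : deviceObservable (ω : Set 𝔼) hfin n x = fun _ => 1 := by
    funext σ
    unfold deviceObservable
    refine Finset.prod_eq_one fun i _ => ?_
    have hE : IsEmpty ↥hfin.toFinset :=
      ⟨fun v => (Set.eq_empty_iff_forall_notMem.1 hω) _ (hfin.mem_toFinset.1 v.2)⟩
    rw [Finset.univ_eq_empty, Finset.filter_empty, Finset.prod_empty]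
  rw [hobs, isingExpect]
  simp

/-- For `n = 0` the integrand is the indicator of the finite configurations (the empty product has
expectation `1`). [folklore] -/
theorem deviceGibbsAverage_zero (β : ℝ) (x : Fin 0 → 𝔼) (ω : PointConfig 𝔼) :
    deviceGibbsAverage β 0 x ω = {ω : PointConfig 𝔼 | (ω : Set 𝔼).Finite}.indicator 1 ω := by
  by_cases h : (ω : Set 𝔼).Finite
  · have hmem : ω ∈ {ω : PointConfig 𝔼 | (ω : Set 𝔼).Finite} := h
    rw [Set.indicator_of_mem hmem, deviceGibbsAverage, dif_pos h]
    have hobs : deviceObservable (ω : Set 𝔼) h 0 x = fun _ => 1 := by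
      funext σ; simp [deviceObservable]
    rw [hobs, isingExpect]
    simp
  · have hmem : ω ∉ {ω : PointConfig 𝔼 | (ω : Set 𝔼).Finite} := h
    rw [Set.indicator_of_notMem hmem, deviceGibbsAverage, dif_neg h]

/-- **Odd `n`: only the empty configuration survives.** For odd `n` the integrand is the indicator
of `{ω = ∅}`: on a finite non-empty configuration the observable is odd under the global spin flip
(`deviceObservable_neg`), so its free zero-field expectation vanishes
(`isingExpect_univ_free_eq_zero_of_odd`; Friedli–Velenik 2017, eq. (3.33)), while on `∅` it is `1`.
[cite: FriedliVelenik2017, §3.7.1] -/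
theorem deviceGibbsAverage_of_odd (β : ℝ) {n : ℕ} (hn : Odd n) (x : Fin n → 𝔼)
    (ω : PointConfig 𝔼) :
    deviceGibbsAverage β n x ω = {ω : PointConfig 𝔼 | (ω : Set 𝔼) = ∅}.indicator 1 ω := by
  by_cases hω : (ω : Set 𝔼) = ∅
  · have hmem : ω ∈ {ω : PointConfig 𝔼 | (ω : Set 𝔼) = ∅} := hω
    rw [Set.indicator_of_mem hmem, deviceGibbsAverage_of_eq_empty β n x hω, Pi.one_apply]
  · have hmem : ω ∉ {ω : PointConfig 𝔼 | (ω : Set 𝔼) = ∅} := hω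
    rw [Set.indicator_of_notMem hmem]
    by_cases hfin : (ω : Set 𝔼).Finite
    · rw [deviceGibbsAverage, dif_pos hfin]
      refine isingExpect_univ_free_eq_zero_of_odd _ β fun σ => ?_
      rw [deviceObservable_neg hfin (Set.nonempty_iff_ne_empty.2 hω), hn.neg_one_pow, neg_one_mul]
    · rw [deviceGibbsAverage, dif_neg hfin]

/-- The quenched Gibbs average is a symmetric function of the `n` marked points. [folklore] -/
theorem deviceGibbsAverage_comp_perm (β : ℝ) {n : ℕ} (e : Equiv.Perm (Fin n)) (x : Fin n → 𝔼)
    (ω : PointConfig 𝔼) : deviceGibbsAverage β n (x ∘ e) ω = deviceGibbsAverage β n x ω := by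
  unfold deviceGibbsAverage
  split_ifs with h
  · have hobs : deviceObservable _ h n (x ∘ e) = deviceObservable _ h n x := by
      funext σ
      exact Fintype.prod_equiv e _ _ fun i => rfl
    rw [hobs]
  · rfl

/-! #### Two measurable events of configurations -/

/-- The event "the configuration is empty" is measurable for the count σ-algebra (it is
`{N(univ) = 0}`; Kingman 1993, §2.1). [folklore] -/
theorem measurableSet_setOf_coe_eq_empty :
    MeasurableSet {ω : PointConfig 𝔼 | (ω : Set 𝔼) = ∅} := by
  have hset : {ω : PointConfig 𝔼 | (ω : Set 𝔼) = ∅} =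
      (fun ω : PointConfig 𝔼 => ω.count Set.univ) ⁻¹' {0} := by
    ext ω
    simp [PointConfig.count]
  rw [hset]
  exact PointConfig.measurable_count MeasurableSet.univ (measurableSet_singleton 0)

/-- The event "the configuration is finite" is measurable for the count σ-algebra (it is
`{N(univ) < ∞}`; Kingman 1993, §2.1). [folklore] -/
theorem measurableSet_setOf_coe_finite :
    MeasurableSet {ω : PointConfig 𝔼 | (ω : Set 𝔼).Finite} := by
  have hset : {ω : PointConfig 𝔼 | (ω : Set 𝔼).Finite} =
      (fun ω : PointConfig 𝔼 => ω.count Set.univ) ⁻¹' {⊤}ᶜ := by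
    ext ω
    simp [PointConfig.count]
  rw [hset]
  exact PointConfig.measurable_count MeasurableSet.univ (measurableSet_singleton _).compl

/-! #### The annealed correlator -/

/-- `|F_P^β(n, x)| ≤ P(all configurations)` for any finite law `P`, WITHOUT any measurability of
the integrand (a non-integrable integrand has Bochner integral `0`). [folklore] -/
theorem abs_annealedDeviceCorr_le (P : Measure (PointConfig 𝔼)) [IsFiniteMeasure P] (β : ℝ) (n : ℕ)
    (x : Fin n → 𝔼) : |annealedDeviceCorr P β n x| ≤ P.real Set.univ := by
  rw [annealedDeviceCorr_eq_integral, ← Real.norm_eq_abs]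
  calc _ ≤ 1 * P.real Set.univ :=
        norm_integral_le_of_norm_le_const (Filter.Eventually.of_forall fun ω => by
          rw [Real.norm_eq_abs]; exact abs_deviceGibbsAverage_le_one β n x ω)
    _ = P.real Set.univ := one_mul _

/-- `|F_P^β(n, x)| ≤ 1` for a probability law `P` (the requested bound `|annealedDeviceCorr| ≤ 1`).
[folklore] -/
theorem abs_annealedDeviceCorr_le_one (P : Measure (PointConfig 𝔼)) [IsProbabilityMeasure P]
    (β : ℝ) (n : ℕ) (x : Fin n → 𝔼) : |annealedDeviceCorr P β n x| ≤ 1 := by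
  simpa using abs_annealedDeviceCorr_le P β n x

/-- **Normalisation**: `F_P^β(0, ·) = P {ω finite}`, which is `1` exactly for an a.s. finite law
(e.g. a Poisson law of finite total intensity). [folklore] -/
theorem annealedDeviceCorr_zero (P : Measure (PointConfig 𝔼)) (β : ℝ) (x : Fin 0 → 𝔼) :
    annealedDeviceCorr P β 0 x = P.real {ω | (ω : Set 𝔼).Finite} := by
  rw [annealedDeviceCorr_eq_integral]
  simp only [deviceGibbsAverage_zero]
  exact integral_indicator_one measurableSet_setOf_coe_finite

/-- **Odd correlators see only the empty configuration**: for odd `n`,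
`F_P^β(n, x) = P {ω = ∅}` — spin-flip symmetry of the free zero-field state kills every non-empty
configuration (Friedli–Velenik 2017, eq. (3.33)) and the empty one contributes `1`; so the odd
correlators do NOT vanish identically unless `P {∅} = 0`. [cite: FriedliVelenik2017, §3.7.1] -/
theorem annealedDeviceCorr_of_odd (P : Measure (PointConfig 𝔼)) (β : ℝ) {n : ℕ} (hn : Odd n)
    (x : Fin n → 𝔼) : annealedDeviceCorr P β n x = P.real {ω | (ω : Set 𝔼) = ∅} := by
  rw [annealedDeviceCorr_eq_integral]
  simp only [deviceGibbsAverage_of_odd β hn]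
  exact integral_indicator_one measurableSet_setOf_coe_eq_empty

/-- For a Poisson law `P` of finite total intensity `ν(ℝᵈ) < ∞` (the route's device), the odd
annealed correlators equal the void probability `e^{-ν(ℝᵈ)}` (Last–Penrose 2017, Def. 3.1 at
`k = 0`; `IsPoissonPointProcess.measureReal_count_eq_zero`). [cite: LastPenrose2017, Def 3.1] -/
theorem annealedDeviceCorr_of_odd_of_isPoissonPointProcess {ν : Measure 𝔼} [IsFiniteMeasure ν]
    {P : Measure (PointConfig 𝔼)} (hP : IsPoissonPointProcess ν P) (β : ℝ) {n : ℕ} (hn : Odd n)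
    (x : Fin n → 𝔼) : annealedDeviceCorr P β n x = Real.exp (-(ν Set.univ).toReal) := by
  rw [annealedDeviceCorr_of_odd P β hn x,
    ← hP.measureReal_count_eq_zero MeasurableSet.univ (measure_ne_top ν _)]
  congr 1
  ext ω
  simp [PointConfig.count]

/-- The annealed correlator is a symmetric function of the `n` marked points. [folklore] -/
theorem annealedDeviceCorr_comp_perm (P : Measure (PointConfig 𝔼)) (β : ℝ) {n : ℕ}
    (e : Equiv.Perm (Fin n)) (x : Fin n → 𝔼) :
    annealedDeviceCorr P β n (x ∘ e) = annealedDeviceCorr P β n x := by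
  rw [annealedDeviceCorr_eq_integral, annealedDeviceCorr_eq_integral]
  simp only [deviceGibbsAverage_comp_perm]

end Device

end Literature.Probability.LatticeModels
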